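import Literature.NumberTheory.EllipticCurves.ThreeTorsionDescentValuation
import Literature.NumberTheory.EllipticCurves.VariableChangePoints
import HarnessLib

/-!
# The `3`-descent map on the `3`-isogenous curve: `α̂(x, y) = y − √−3·(mx + (27s + 8m³)/9)` on
# Vélu's quotient `E_{m,s}/⟨T⟩` (Cohen–Pazuki, *Elementary 3-descent with a 3-isogeny*, Def. 1.3 with `D̂ = −3`)

Topic `NumberTheory/EllipticCurves`. Sequel of `ThreeTorsionDescentHom` / `ThreeTorsionDescentValuation`
(the map `α` of [CohenPazuki2009] Def. 1.3 for `D = 1` on `threeTorsionModel m s : y² = x³ + (mx + s)²`,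
its multiplicativity and its valuations). Everything here is proved; no named facts.

Source [CohenPazuki2009] §1 (held `paper:arxiv-0903.4963`), VERBATIM (Definition 1.3): «The curve `Ê` is
defined by a similar equation `y² = x³ + D̂(âx + b̂)²`, where `D̂ = −3D`, `â = a`, and `b̂ = (27b − 4a³D)/9`,
and the corresponding `3`-descent map is denoted `α̂`» — with (general `D`) «`α((x, y)) = y − (ax + b)√D`»,
valued in «the subgroup `G₃` of classes of elements of `K*/K*³` whose norm is a cube», `K = ℚ(√D)`.

## What is formalized (`D = 1`, so `D̂ = −3`; over any field `F` containing `θ` with `θ² = −3`, `3 ≠ 0`)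

The tree's model of the `3`-isogenous curve is Vélu's `threeIsogenyCodomain m s = [0, m², 0, −18ms,
−(27s² + 16m³s)]` (`ThreeIsogeny`); Cohen–Pazuki's `Ê : y² = x³ − 3(mx + b̂)²`, `b̂ = (27s − 4m³)/9`, is its
translate by `x ↦ x + 4m²/3`, and over `F ∋ θ = √−3` it IS a three-torsion model:
`Ê = threeTorsionModel (mθ) (b̂θ)` (`y² = x³ + (mθ·x + b̂θ)² = x³ − 3(mx + b̂)²`).

* `ThreeTorsionDescent.bHat m s = (27s − 4m³)/9`, `codomainShift m = (1, −4m²/3, 0, 0)` and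
  **`codomainShift_smul`**: `codomainShift m • threeIsogenyCodomain m s = threeTorsionModel (mθ) (b̂θ)`.
* **`codescent m s θ : (E/⟨T⟩)(F) → F`** — Cohen–Pazuki's `α̂` read over `F ∋ θ`: the map `α` of the
  three-torsion model `(mθ, b̂θ)` transported along the tree's point isomorphism
  `VariableChange.pointEquiv`; explicitly `α̂(O) = 1`, **`α̂(x, y) = y − θ(mx + (27s + 8m³)/9)`**
  (`codescent_some_of_ne`) off the point `T̂` where this vanishes, where the value is `(2b̂θ)²`.
* **`codescentClass_add`** — `α̂` is a homomorphism to `Fˣ/Fˣ³` (`2 ≠ 0`, `b̂ ≠ 0`, `θ ≠ 0`).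
* `codescent_mul_conj` — **the norm identity** `α̂(P)·(y + θ(mx + (27s + 8m³)/9)) = (x + 4m²/3)³`: for
  `m, s, x, y` in a subfield over which `θ` is quadratic, the conjugate of `α̂(P)` is the second factor,
  so `N(α̂(P))` is a cube — the «norm is a cube» clause of Definition 1.3.
* `three_dvd_log_codescent` — `3 ∣ ord_v(α̂(P))` at every valuation with `v(2b̂θ) = 1`, `v(2mθ) ≤ 1`
  (from `Valuation.three_dvd_log_threeTorsionDescent`).

Use (route ShaPrimaryTransfer, cross-prime carrier `y² − 21xy + 6137y = x³`, i.e. `(m, s) = (−21/2, 6137/2)`,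
`b̂ = 9720`): the images of the RATIONAL points of `E/⟨T⟩` in `ℚ(ζ₃)*/ℚ(ζ₃)*³` are cube-normed and
unramified outside `{λ, 2, 5}`, hence lie in `⟨[ζ₃]⟩` — the Selmer box of the `ℤ/3ℤ`-kernel side.

## References

* [CohenPazuki2009] H. Cohen, F. Pazuki, Acta Arith. 140 (2009) 369–404: Definition 1.3, Proposition 1.4,
  Proposition 2.2 (`Ê : y² = x³ − 3D(ax + (27b − 4a³D)/9)²`).
* [CremonaAlgorithms1997] J. E. Cremona, *Algorithms for Modular Elliptic Curves*, §3.8 (Vélu's model of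
  the quotient, the tree's `threeIsogenyCodomain`).
* Tree: `ThreeIsogeny`, `ThreeTorsionDescentHom`, `ThreeTorsionDescentValuation`, `VariableChangePoints`.
-/

noncomputable section

open scoped Classical WithZero

open WeierstrassCurve

universe u

namespace Literature.NumberTheory.EllipticCurves

namespace ThreeTorsionDescent

open MordellDescent

variable {F : Type u} [Field F]

/-! ## Cohen–Pazuki's model of the quotient curve -/

/-- Cohen–Pazuki's `b̂ = (27b − 4a³D)/9` for `(a, b, D) = (m, s, 1)`. [cite: CohenPazuki2009, Definition 1.3] -/
def bHat (m s : F) : F := (27 * s - 4 * m ^ 3) / 9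

/-- The translation `x ↦ x + 4m²/3` (`(u, r, s, t) = (1, −4m²/3, 0, 0)`) carrying Vélu's model
`threeIsogenyCodomain m s` to Cohen–Pazuki's `Ê`. [cite: CohenPazuki2009, Definition 1.3 (the formula for φ: the term (a²/3)x²)] -/
def codomainShift (m : F) : VariableChange F := ⟨1, -(4 * m ^ 2 / 3), 0, 0⟩

/-- The shift acts on `x` by `x ↦ x + 4m²/3`. [cite: CohenPazuki2009, Definition 1.3] -/
theorem codomainShift_toX (m x : F) : (codomainShift m).toX x = x + 4 * m ^ 2 / 3 := by
  simp [VariableChange.toX, codomainShift]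

/-- The shift does not change `y`. [cite: CohenPazuki2009, Definition 1.3] -/
theorem codomainShift_toY (m x y : F) : (codomainShift m).toY x y = y := by
  simp [VariableChange.toY, codomainShift]

/-- **Cohen–Pazuki's `Ê` is a three-torsion model over `F ∋ θ = √−3`**:
`codomainShift m • threeIsogenyCodomain m s = threeTorsionModel (mθ) (b̂θ)`, i.e. Vélu's
`y² = x³ + m²x² − 18msx − (27s² + 16m³s)` becomes `y² = x³ − 3(mx + b̂)² = x³ + (mθx + b̂θ)²` after
`x ↦ x + 4m²/3`. [cite: CohenPazuki2009, Definition 1.3 and Proposition 2.2 (the equation of Ê)] -/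
theorem codomainShift_smul {m s θ : F} (hθ : θ ^ 2 = -3) (h3 : (3 : F) ≠ 0) :
    codomainShift m • threeIsogenyCodomain m s = threeTorsionModel (m * θ) (bHat m s * θ) := by
  have h9 : (9 : F) ≠ 0 := by
    rw [show (9 : F) = 3 * 3 by norm_num]; exact mul_ne_zero h3 h3
  ext
  · simp [codomainShift, threeIsogenyCodomain, threeTorsionModel, variableChange_a₁]
  · simp only [codomainShift, threeIsogenyCodomain, threeTorsionModel, variableChange_a₂, inv_one,
      Units.val_one, one_pow, one_mul, mul_zero, sub_zero, zero_pow two_ne_zero]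
    rw [mul_pow, hθ]
    field_simp
    ring
  · simp [codomainShift, threeIsogenyCodomain, threeTorsionModel, variableChange_a₃]
  · simp only [codomainShift, threeIsogenyCodomain, threeTorsionModel, variableChange_a₄, inv_one,
      Units.val_one, one_pow, one_mul, mul_zero, sub_zero, add_zero, bHat]
    have e : 2 * (m * θ) * ((27 * s - 4 * m ^ 3) / 9 * θ) = 2 * m * ((27 * s - 4 * m ^ 3) / 9) * θ ^ 2 := by
      ring
    rw [e, hθ]
    field_simp
    ring
  · simp only [codomainShift, threeIsogenyCodomain, threeTorsionModel, variableChange_a₆, inv_one,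
      Units.val_one, one_pow, one_mul, mul_zero, sub_zero, bHat]
    rw [mul_pow, hθ]
    field_simp
    ring

/-- `(27s + 8m³)/9 = 4m³/3 + b̂`: the constant term of the linear form in `α̂`. [cite: CohenPazuki2009, Definition 1.3] -/
theorem bHat_add {m s : F} (h3 : (3 : F) ≠ 0) :
    m * (4 * m ^ 2 / 3) + bHat m s = (27 * s + 8 * m ^ 3) / 9 := by
  have h9 : (9 : F) ≠ 0 := by
    rw [show (9 : F) = 3 * 3 by norm_num]; exact mul_ne_zero h3 h3
  rw [bHat]
  field_simp
  ring

/-! ## The descent map `α̂` on the quotient curve -/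

variable (m s θ : F)

/-- **Cohen–Pazuki's `α̂` read over `F ∋ θ = √−3`**: the `3`-descent map of the three-torsion model
`(mθ, b̂θ)` transported to the points of Vélu's `threeIsogenyCodomain m s` along `x ↦ x + 4m²/3`;
`α̂(x, y) = y − θ(mx + (27s + 8m³)/9)` off `T̂`, `α̂(T̂) = (2b̂θ)²`, `α̂(O) = 1`. [cite: CohenPazuki2009, Definition 1.3] -/
def codescent (P : (threeIsogenyCodomain m s).toAffine.Point) : F :=
  descent (codomainShift m • threeIsogenyCodomain m s) (m * θ) (bHat m s * θ)
    (VariableChange.pointEquiv (threeIsogenyCodomain m s) (codomainShift m) P)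

/-- The class `[α̂(P)] ∈ Fˣ/Fˣ³`. [cite: CohenPazuki2009, Definition 1.3] -/
def codescentClass (P : (threeIsogenyCodomain m s).toAffine.Point) : CubeUnits F :=
  cubeClass (codescent m s θ P)

/-- `α̂(O) = 1`. [cite: CohenPazuki2009, Definition 1.3] -/
@[simp] theorem codescent_zero : codescent m s θ 0 = 1 := by
  rw [codescent, VariableChange.pointEquiv_zero]; rfl

/-- `[α̂(O)] = 1`. [cite: CohenPazuki2009, Definition 1.3] -/
@[simp] theorem codescentClass_zero : codescentClass m s θ 0 = 1 := by
  rw [codescentClass, codescent_zero, cubeClass_one]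

variable {m s θ}

/-- **`α̂(x, y) = y − θ(mx + (27s + 8m³)/9)`** at an affine point where this is non-zero.
[cite: CohenPazuki2009, Definition 1.3 (α̂((x,y)) = y − (âx + b̂)√D̂)] -/
theorem codescent_some_of_ne (h3 : (3 : F) ≠ 0) {x y : F}
    (h : (threeIsogenyCodomain m s).toAffine.Nonsingular x y)
    (hne : y - θ * (m * x + (27 * s + 8 * m ^ 3) / 9) ≠ 0) :
    codescent m s θ (.some x y h) = y - θ * (m * x + (27 * s + 8 * m ^ 3) / 9) := by
  have e : y - m * θ * (x + 4 * m ^ 2 / 3) - bHat m s * θ = y - θ * (m * x + (27 * s + 8 * m ^ 3) / 9) := by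
    rw [← bHat_add h3]; ring
  rw [codescent, VariableChange.pointEquiv_some, descent_some, codomainShift_toX, codomainShift_toY,
    if_neg (by rw [e]; exact hne), e]

/-- `α̂` at the point `T̂` where `y − θ(mx + (27s + 8m³)/9)` vanishes: the value `(2b̂θ)²`.
[cite: CohenPazuki2009, Definition 1.3] -/
theorem codescent_some_of_eq (h3 : (3 : F) ≠ 0) {x y : F}
    (h : (threeIsogenyCodomain m s).toAffine.Nonsingular x y)
    (heq : y - θ * (m * x + (27 * s + 8 * m ^ 3) / 9) = 0) :
    codescent m s θ (.some x y h) = (2 * (bHat m s * θ)) ^ 2 := by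
  have e : y - m * θ * (x + 4 * m ^ 2 / 3) - bHat m s * θ = y - θ * (m * x + (27 * s + 8 * m ^ 3) / 9) := by
    rw [← bHat_add h3]; ring
  rw [codescent, VariableChange.pointEquiv_some, descent_some, codomainShift_toX, codomainShift_toY,
    if_pos (by rw [e]; exact heq)]

/-- **`α̂` is a homomorphism `(E/⟨T⟩)(F) → Fˣ/Fˣ³`** (`θ² = −3`, `2, 3 ≠ 0`, `b̂ ≠ 0`, `θ ≠ 0`):
`[α̂(P + Q)] = [α̂(P)][α̂(Q)]` — Proposition 1.4 (2) for `Ê` over `F ∋ √−3`, by transport of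
`descentClass_add` along the point isomorphism of the translation. [cite: CohenPazuki2009, Proposition 1.4 (2)] -/
theorem codescentClass_add (hθ : θ ^ 2 = -3) (h2 : (2 : F) ≠ 0) (h3 : (3 : F) ≠ 0)
    (hb : bHat m s ≠ 0) (hθ0 : θ ≠ 0) (P Q : (threeIsogenyCodomain m s).toAffine.Point) :
    codescentClass m s θ (P + Q) = codescentClass m s θ P * codescentClass m s θ Q := by
  simp only [codescentClass, codescent, map_add]
  exact descentClass_add (codomainShift_smul hθ h3) h2 (mul_ne_zero hb hθ0) _ _

/-- `[α̂(−P)] [α̂(P)] = 1`. [cite: CohenPazuki2009, Proposition 1.4 (2)] -/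
theorem codescentClass_neg_mul (hθ : θ ^ 2 = -3) (h2 : (2 : F) ≠ 0) (h3 : (3 : F) ≠ 0)
    (hb : bHat m s ≠ 0) (hθ0 : θ ≠ 0) (P : (threeIsogenyCodomain m s).toAffine.Point) :
    codescentClass m s θ (-P) * codescentClass m s θ P = 1 := by
  rw [← codescentClass_add hθ h2 h3 hb hθ0, neg_add_cancel, codescentClass_zero]

/-- **The norm identity**: on `E/⟨T⟩`, `(y − θL)(y + θL) = (x + 4m²/3)³` with `L = mx + (27s + 8m³)/9`
(the curve is `y² = (x + 4m²/3)³ − 3L²`); so when `m, s, x, y` lie in a subfield over which `θ` is a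
conjugate of `−θ`, the norm of `α̂(P)` is the cube `(x + 4m²/3)³` — the «norm is a cube» clause of `G₃`.
[cite: CohenPazuki2009, Definition 1.3 (G₃: classes whose norm is a cube)] -/
theorem codescent_mul_conj (hθ : θ ^ 2 = -3) (h3 : (3 : F) ≠ 0) {x y : F}
    (h : (threeIsogenyCodomain m s).toAffine.Equation x y) :
    (y - θ * (m * x + (27 * s + 8 * m ^ 3) / 9)) * (y + θ * (m * x + (27 * s + 8 * m ^ 3) / 9)) =
      (x + 4 * m ^ 2 / 3) ^ 3 := by
  have h9 : (9 : F) ≠ 0 := by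
    rw [show (9 : F) = 3 * 3 by norm_num]; exact mul_ne_zero h3 h3
  have hE : y ^ 2 = x ^ 3 + m ^ 2 * x ^ 2 - 18 * m * s * x - (27 * s ^ 2 + 16 * m ^ 3 * s) := by
    rw [Affine.equation_iff, threeIsogenyCodomain_a₁, threeIsogenyCodomain_a₂, threeIsogenyCodomain_a₃,
      threeIsogenyCodomain_a₄, threeIsogenyCodomain_a₆] at h
    linear_combination h
  have e : (y - θ * (m * x + (27 * s + 8 * m ^ 3) / 9)) * (y + θ * (m * x + (27 * s + 8 * m ^ 3) / 9)) =
      y ^ 2 - θ ^ 2 * (m * x + (27 * s + 8 * m ^ 3) / 9) ^ 2 := by ring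
  rw [e, hθ, hE]
  field_simp
  ring

/-- **`3 ∣ ord_v(α̂(P))`** for every point `P` of `E/⟨T⟩` and every valuation with `v(2b̂θ) = 1`,
`v(2mθ) ≤ 1` (the descent classes of `Ê` are unramified outside the primes dividing `2b̂√−3`).
[cite: CohenPazuki2009, Theorem 2.1 (2) (applied to Ê)] -/
theorem three_dvd_log_codescent (v : Valuation F ℤᵐ⁰) (hθ : θ ^ 2 = -3) (h3 : (3 : F) ≠ 0)
    (hvs : v (2 * (bHat m s * θ)) = 1) (hvm : v (2 * (m * θ)) ≤ 1)
    (P : (threeIsogenyCodomain m s).toAffine.Point) :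
    (3 : ℤ) ∣ WithZero.log (v (codescent m s θ P)) :=
  v.three_dvd_log_threeTorsionDescent (codomainShift_smul hθ h3) hvs hvm _

end ThreeTorsionDescent

end Literature.NumberTheory.EllipticCurves
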